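import Literature.Algebra.Polynomial.CasasAlvero
import Mathlib.Algebra.CharP.Lemmas
import Mathlib.Algebra.Polynomial.Coeff
import Mathlib.RingTheory.Polynomial.Basic
import Mathlib.FieldTheory.Perfect
import HarnessLib

/-!
# Casas-Alvero polynomials of degree `p^k` and `2p^k` in characteristic `p`
(Graf von Bothmer–Labs–Schicho–van de Woestijne, *The Casas-Alvero conjecture for infinitely many
degrees*, J. Algebra 316 (2007) 224–230, §2)

The characteristic-`p` half of the theorem of [GvBLSW 2007] ("the Casas-Alvero conjecture holds in
characteristic `0` in degrees `p^k` and `2p^k`"): over a field (indeed any commutative ring) of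
characteristic `p`,

* `coeff_eq_zero_of_natDegree_eq_prime_pow` — a monic Casas-Alvero polynomial (`IsCasasAlvero`: a
  common root with EVERY Hasse derivative `H_i f`, `0 < i < deg f`) of degree `p^k` has no middle
  coefficients, i.e. `f = X^(p^k) + C (f 0)` (`eq_X_pow_add_C_of_natDegree_eq_prime_pow`); this is
  [GvBLSW 2007, Prop. 5: `X_{p^k}(𝔽̄_p) = ∅`], whose proof is the induction formalised here: the Hasse
  derivative of order `i` is the nonzero constant `[X^i] f` as long as all higher middle coefficients vanish,
  because `p ∣ C(p^k, i)` kills the contribution of the leading term;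
* `holdsInDegree_prime_pow` — hence over a PERFECT ring of characteristic `p` (e.g. `𝔽̄_p`) every such `f`
  is `(X - a)^(p^k)`: the Casas-Alvero property `HoldsInDegree R (p^k)`;
* `coeff_eq_zero_of_natDegree_eq_two_mul_prime_pow`, `holdsInDegree_two_mul_prime_pow` — the same in
  degree `2p^k` over a perfect ring of characteristic `p` [GvBLSW 2007, Prop. 3 + Prop. 6 with `n = 2`,
  proof of the Theorem]: all coefficients except those of `X^0, X^(p^k), X^(2p^k)` vanish, and the condition
  of order `p^k` then forces `f = (X^(p^k) - u)^2 = (X - t)^(2p^k)` (division-free, so all `p` at once).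

The binomial arithmetic (`p ∣ C(p^k, i)` for `0 < i < p^k`; `p ∣ C(2p^k, i)` for `0 < i < 2p^k`, `i ≠ p^k`;
`C(2p^k, p^k) ≡ 2`) is read off the characteristic-`p` identities `(X+1)^(p^k) = X^(p^k) + 1` and
`(X+1)^(2p^k) = (X^(p^k)+1)^2` in `R[X]` (`cast_choose_*`), which is [GvBLSW 2007, Lemma 4] (Kummer) in the
two instances needed.

NOT here: the transfer to characteristic `0` [GvBLSW 2007, Prop. 2] (properness of the weighted projective
scheme `X_d → Spec ℤ`), hence not the characteristic-`0` theorem itself; the general reduction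
`X_n(𝔽̄_p) = ∅ ⇒ X_{np^k}(𝔽̄_p) = ∅` [GvBLSW 2007, Prop. 6] (needs Hasse derivatives of `p^k`-th powers).
`HoldsInDegree R d` is a definition (the degree-`d` Casas-Alvero property over `R`, a predicate like Mathlib's
`FermatLastTheoremFor`), proved here for the two degree families in characteristic `p`; no statement about
characteristic `0` is asserted or assumed (no named facts added). No `sorry`, no new axioms.
-/

noncomputable section

open Polynomial

namespace Literature.Algebra.Polynomial.CasasAlvero

variable {R : Type*} [CommRing R]

/-- The Casas-Alvero property IN DEGREE `d` OVER `R` (a predicate on the pair `(R, d)`, in the style of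
Mathlib's `FermatLastTheoremFor n`): every monic `f ∈ R[X]` of degree `d` that has a common root in `R` with
each Hasse derivative `H_i f`, `0 < i < d` (`IsCasasAlvero f`), is `(X - a)^d` for some `a ∈ R`. Over an
algebraically closed field this says "there is no CA-polynomial of degree `d` over `k`" in the sense of
[GvBLSW 2007, Prop. 1] / [CLO 2014, Def. 1]; over other rings the hypothesis (roots in `R` itself) is
stronger, so the property is weaker. PROVED below for `d = p^k` and `d = 2p^k` over perfect rings of
characteristic `p` (`holdsInDegree_prime_pow`, `holdsInDegree_two_mul_prime_pow`).
[cite: GrafVonBothmerEtAl2007, Prop. 1] -/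
def HoldsInDegree (R : Type*) [CommRing R] (d : ℕ) : Prop :=
  ∀ f : R[X], f.Monic → f.natDegree = d → IsCasasAlvero f → ∃ a : R, f = (X - C a) ^ d

/-- If `C(j,i) · [X^j] f = 0` for every `j > i`, then the `i`-th Hasse derivative of `f` is the constant
`[X^i] f` (from `[X^m] H_i f = C(m+i, i) [X^(m+i)] f`). [folklore] -/
theorem hasseDeriv_eq_C_of_coeff {f : R[X]} {i : ℕ}
    (h : ∀ j, i < j → ((j.choose i : ℕ) : R) * f.coeff j = 0) :
    hasseDeriv i f = C (f.coeff i) := by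
  ext m
  rw [hasseDeriv_coeff, coeff_C]
  rcases Nat.eq_zero_or_pos m with rfl | hm
  · rw [if_pos rfl, zero_add, Nat.choose_self, Nat.cast_one, one_mul]
  · rw [if_neg hm.ne']
    exact h (m + i) (by omega)

/-- A Hasse derivative that is the constant `[X^i] f` and shares a root with `f` forces `[X^i] f = 0`.
[folklore] -/
theorem coeff_eq_zero_of_sharesRoot_of_hasseDeriv_eq_C {f : R[X]} {i : ℕ}
    (hH : hasseDeriv i f = C (f.coeff i)) (hs : SharesRoot f (hasseDeriv i f)) : f.coeff i = 0 := by
  obtain ⟨θ, -, hθ⟩ := hs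
  rwa [hH, eval_C] at hθ

section CharP

variable {p : ℕ} [hp : Fact p.Prime] [CharP R p]

variable (R) in
/-- In characteristic `p`, `C(p^k, i) = 0` in `R` for `0 < i < p^k` — read off `(X+1)^(p^k) = X^(p^k) + 1`
in `R[X]` (equivalently Kummer's theorem, [GvBLSW 2007, Lemma 4]). [cite: GrafVonBothmerEtAl2007, Lemma 4] -/
theorem cast_choose_prime_pow_eq_zero (k : ℕ) {i : ℕ} (hi0 : 0 < i) (hi : i < p ^ k) :
    (((p ^ k).choose i : ℕ) : R) = 0 := by
  rw [← coeff_X_add_one_pow R (p ^ k) i, add_pow_char_pow, one_pow, coeff_add, coeff_X_pow, coeff_one,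
    if_neg hi.ne, if_neg hi0.ne', add_zero]

variable (R) in
/-- In characteristic `p`, `C(2p^k, i) = 0` in `R` for `0 < i < 2p^k`, `i ≠ p^k` — read off
`(X+1)^(2p^k) = (X^(p^k)+1)^2 = X^(2p^k) + 2X^(p^k) + 1` in `R[X]` [GvBLSW 2007, Lemma 4 with `d = 2p^k`].
[cite: GrafVonBothmerEtAl2007, Lemma 4] -/
theorem cast_choose_two_mul_prime_pow_eq_zero (k : ℕ) {i : ℕ} (hi0 : 0 < i) (hi : i < 2 * p ^ k)
    (hne : i ≠ p ^ k) : (((2 * p ^ k).choose i : ℕ) : R) = 0 := by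
  have h2 : ((X + 1 : R[X]) ^ (2 * p ^ k)) = X ^ (2 * p ^ k) + C (2 : R) * X ^ (p ^ k) + 1 := by
    rw [mul_comm 2 (p ^ k), pow_mul, pow_mul, add_pow_char_pow, one_pow, map_ofNat]
    ring
  rw [← coeff_X_add_one_pow R (2 * p ^ k) i, h2]
  simp only [coeff_add, coeff_X_pow, coeff_C_mul, coeff_one]
  rw [if_neg hi.ne, if_neg hne, if_neg hi0.ne', mul_zero, add_zero, add_zero]

variable (R) in
/-- In characteristic `p`, `C(2p^k, p^k) = 2` in `R` (Lucas/Kummer; here from `(X+1)^(2p^k) = (X^(p^k)+1)^2`).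
[cite: GrafVonBothmerEtAl2007, Lemma 4] -/
theorem cast_choose_two_mul_prime_pow_self (k : ℕ) :
    (((2 * p ^ k).choose (p ^ k) : ℕ) : R) = 2 := by
  have hq : 0 < p ^ k := pow_pos hp.out.pos k
  have h2 : ((X + 1 : R[X]) ^ (2 * p ^ k)) = X ^ (2 * p ^ k) + C (2 : R) * X ^ (p ^ k) + 1 := by
    rw [mul_comm 2 (p ^ k), pow_mul, pow_mul, add_pow_char_pow, one_pow, map_ofNat]
    ring
  rw [← coeff_X_add_one_pow R (2 * p ^ k) (p ^ k), h2]
  simp only [coeff_add, coeff_X_pow, coeff_C_mul, coeff_one]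
  rw [if_neg (by omega : p ^ k ≠ 2 * p ^ k), if_neg hq.ne']
  simp

/-- **Degree `p^k`, characteristic `p`** [GvBLSW 2007, Prop. 5 and its proof]: a Casas-Alvero
polynomial `f` of degree `p^k` (monic or not) over a commutative ring of characteristic `p` has
`[X^i] f = 0` for all `0 < i < p^k`. Proof: descending induction on `i`; when all middle coefficients above `i` vanish,
`H_i f = C(p^k, i) X^(p^k - i) + [X^i] f = [X^i] f` (as `p ∣ C(p^k, i)`), a constant, which can share a root
with `f` only if it is `0`. [cite: GrafVonBothmerEtAl2007, Prop. 5] -/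
theorem coeff_eq_zero_of_natDegree_eq_prime_pow {f : R[X]} {k : ℕ}
    (hd : f.natDegree = p ^ k) (hca : IsCasasAlvero f) {i : ℕ} (hi0 : 0 < i) (hi : i < p ^ k) :
    f.coeff i = 0 := by
  suffices H : ∀ n i, i + n + 1 = p ^ k → 0 < i → f.coeff i = 0 from
    H (p ^ k - 1 - i) i (by omega) hi0
  intro n
  induction n using Nat.strong_induction_on with
  | _ n ih =>
    intro i hin hi0'
    refine coeff_eq_zero_of_sharesRoot_of_hasseDeriv_eq_C ?_ (hca i hi0' (by rw [hd]; omega))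
    apply hasseDeriv_eq_C_of_coeff
    intro j hij
    rcases Nat.lt_trichotomy j (p ^ k) with hlt | rfl | hgt
    · rw [ih (p ^ k - 1 - j) (by omega) j (by omega) (by omega), mul_zero]
    · rw [cast_choose_prime_pow_eq_zero R k hi0' (by omega), zero_mul]
    · rw [coeff_eq_zero_of_natDegree_lt (by rw [hd]; exact hgt), mul_zero]

/-- Degree `p^k`, characteristic `p`: `f = X^(p^k) + C (f 0)` [GvBLSW 2007, proof of Prop. 5:
"`a_1 = … = a_{d-1} = 0`"]. [cite: GrafVonBothmerEtAl2007, Prop. 5] -/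
theorem eq_X_pow_add_C_of_natDegree_eq_prime_pow {f : R[X]} {k : ℕ} (hf : f.Monic)
    (hd : f.natDegree = p ^ k) (hca : IsCasasAlvero f) : f = X ^ (p ^ k) + C (f.coeff 0) := by
  have hq : p ^ k ≠ 0 := pow_ne_zero k hp.out.ne_zero
  ext m
  rw [coeff_add, coeff_X_pow, coeff_C]
  rcases Nat.lt_trichotomy m (p ^ k) with hlt | rfl | hgt
  · rcases Nat.eq_zero_or_pos m with rfl | hm0
    · rw [if_neg (Ne.symm hq), if_pos rfl, zero_add]
    · rw [coeff_eq_zero_of_natDegree_eq_prime_pow hd hca hm0 hlt, if_neg hlt.ne, if_neg hm0.ne',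
        add_zero]
  · rw [if_pos rfl, if_neg hq, add_zero, ← hd, hf.coeff_natDegree]
  · rw [if_neg hgt.ne', if_neg (by omega : m ≠ 0), add_zero,
      coeff_eq_zero_of_natDegree_lt (by rw [hd]; exact hgt)]

/-- **The Casas-Alvero property in degree `p^k` over a perfect ring of characteristic `p`** (e.g. `𝔽̄_p`):
every monic Casas-Alvero polynomial of degree `p^k` is `(X - a)^(p^k)`, with `a = -(f 0)^(1/p^k)`
[GvBLSW 2007, Prop. 5: `X_{p^k}(𝔽̄_p) = ∅`; the `𝔽̄_p`-statement behind the characteristic-`0` theorem for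
`d = p^k`]. [cite: GrafVonBothmerEtAl2007, Prop. 5] -/
theorem holdsInDegree_prime_pow (p : ℕ) [Fact p.Prime] [CharP R p] [PerfectRing R p] (k : ℕ) :
    HoldsInDegree R (p ^ k) := by
  intro f hf hd hca
  have hb : ((iterateFrobeniusEquiv R p k).symm (f.coeff 0)) ^ p ^ k = f.coeff 0 := by
    rw [← iterateFrobeniusEquiv_def, RingEquiv.apply_symm_apply]
  refine ⟨-(iterateFrobeniusEquiv R p k).symm (f.coeff 0), ?_⟩
  rw [map_neg, sub_neg_eq_add, add_pow_char_pow, ← map_pow, hb]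
  exact eq_X_pow_add_C_of_natDegree_eq_prime_pow hf hd hca

/-- **Degree `2p^k`, characteristic `p`** [GvBLSW 2007, proof of Prop. 6 with `n = 2`]: a Casas-Alvero
polynomial of degree `2p^k` (monic or not) over a commutative ring of characteristic `p` has `[X^i] f = 0`
for every `0 < i < 2p^k` with `i ≠ p^k` ("`a_i = 0` unless `p^k ∣ i`"). Same descending induction; the surviving
coefficient of `X^(p^k)` does not interfere because `p ∣ C(p^k, i)` for `0 < i < p^k`, and the leading term
does not because `p ∣ C(2p^k, i)` for `i ≠ p^k`. [cite: GrafVonBothmerEtAl2007, Prop. 6] -/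
theorem coeff_eq_zero_of_natDegree_eq_two_mul_prime_pow {f : R[X]} {k : ℕ}
    (hd : f.natDegree = 2 * p ^ k) (hca : IsCasasAlvero f) {i : ℕ} (hi0 : 0 < i) (hi : i < 2 * p ^ k)
    (hne : i ≠ p ^ k) : f.coeff i = 0 := by
  suffices H : ∀ n i, i + n + 1 = 2 * p ^ k → 0 < i → i ≠ p ^ k → f.coeff i = 0 from
    H (2 * p ^ k - 1 - i) i (by omega) hi0 hne
  intro n
  induction n using Nat.strong_induction_on with
  | _ n ih =>
    intro i hin hi0' hne'
    refine coeff_eq_zero_of_sharesRoot_of_hasseDeriv_eq_C ?_ (hca i hi0' (by rw [hd]; omega))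
    apply hasseDeriv_eq_C_of_coeff
    intro j hij
    rcases Nat.lt_trichotomy j (2 * p ^ k) with hlt | rfl | hgt
    · by_cases hj : j = p ^ k
      · subst hj
        rw [cast_choose_prime_pow_eq_zero R k hi0' hij, zero_mul]
      · rw [ih (2 * p ^ k - 1 - j) (by omega) j (by omega) (by omega) hj, mul_zero]
    · rw [cast_choose_two_mul_prime_pow_eq_zero R k hi0' (by omega) hne', zero_mul]
    · rw [coeff_eq_zero_of_natDegree_lt (by rw [hd]; exact hgt), mul_zero]

/-- Degree `2p^k`, characteristic `p`: `f = X^(2p^k) + C a · X^(p^k) + C c` with `a = [X^(p^k)] f`,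
`c = f 0`. [cite: GrafVonBothmerEtAl2007, Prop. 6] -/
theorem eq_of_natDegree_eq_two_mul_prime_pow {f : R[X]} {k : ℕ} (hf : f.Monic)
    (hd : f.natDegree = 2 * p ^ k) (hca : IsCasasAlvero f) :
    f = X ^ (2 * p ^ k) + C (f.coeff (p ^ k)) * X ^ (p ^ k) + C (f.coeff 0) := by
  have hq : 0 < p ^ k := pow_pos hp.out.pos k
  ext m
  simp only [coeff_add, coeff_X_pow, coeff_C_mul, coeff_C]
  rcases Nat.lt_trichotomy m (2 * p ^ k) with hlt | rfl | hgt
  · rcases Nat.eq_zero_or_pos m with rfl | hm0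
    · rw [if_neg (by omega : (0 : ℕ) ≠ 2 * p ^ k), if_neg (by omega : (0 : ℕ) ≠ p ^ k), if_pos rfl,
        mul_zero, zero_add, zero_add]
    · by_cases hm : m = p ^ k
      · subst hm
        rw [if_neg (by omega : p ^ k ≠ 2 * p ^ k), if_pos rfl, if_neg hq.ne', mul_one, zero_add, add_zero]
      · rw [coeff_eq_zero_of_natDegree_eq_two_mul_prime_pow hd hca hm0 hlt hm, if_neg hlt.ne, if_neg hm,
          if_neg hm0.ne', mul_zero, add_zero, add_zero]
  · rw [if_pos rfl, if_neg (by omega : 2 * p ^ k ≠ p ^ k), if_neg (by omega : 2 * p ^ k ≠ 0), mul_zero,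
      add_zero, add_zero, ← hd, hf.coeff_natDegree]
  · rw [if_neg hgt.ne', if_neg (by omega : m ≠ p ^ k), if_neg (by omega : m ≠ 0), mul_zero, add_zero,
      add_zero, coeff_eq_zero_of_natDegree_lt (by rw [hd]; exact hgt)]

/-- Degree `2p^k`, characteristic `p`: the Hasse derivative of order `p^k` is `2 X^(p^k) + [X^(p^k)] f`
(`C(2p^k, p^k) ≡ 2`, all other contributing coefficients vanish). [cite: GrafVonBothmerEtAl2007, Prop. 6] -/
theorem hasseDeriv_prime_pow_of_natDegree_eq_two_mul_prime_pow {f : R[X]} {k : ℕ} (hf : f.Monic)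
    (hd : f.natDegree = 2 * p ^ k) (hca : IsCasasAlvero f) :
    hasseDeriv (p ^ k) f = C (2 : R) * X ^ (p ^ k) + C (f.coeff (p ^ k)) := by
  have hq : 0 < p ^ k := pow_pos hp.out.pos k
  ext m
  rw [hasseDeriv_coeff, coeff_add, coeff_C_mul, coeff_X_pow, coeff_C]
  rcases Nat.eq_zero_or_pos m with rfl | hm0
  · rw [zero_add, Nat.choose_self, Nat.cast_one, one_mul, if_neg (Ne.symm hq.ne'), if_pos rfl, mul_zero,
      zero_add]
  · rw [if_neg hm0.ne', add_zero]
    by_cases hm : m = p ^ k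
    · subst hm
      rw [if_pos rfl, mul_one, ← two_mul, cast_choose_two_mul_prime_pow_self R k, ← hd, hf.coeff_natDegree,
        mul_one]
    · rw [if_neg hm, mul_zero]
      rcases Nat.lt_or_ge (m + p ^ k) (2 * p ^ k) with hlt | hge
      · rw [coeff_eq_zero_of_natDegree_eq_two_mul_prime_pow hd hca (by omega) hlt (by omega), mul_zero]
      · rw [coeff_eq_zero_of_natDegree_lt (by rw [hd]; omega), mul_zero]

/-- **The Casas-Alvero property in degree `2p^k` over a perfect ring of characteristic `p`** (e.g. `𝔽̄_p`)
[GvBLSW 2007, proof of the Theorem: Prop. 3 (degree `2`) + Prop. 6 (`n = 2`) give `X_{2p^k}(𝔽̄_p) = ∅`].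
By the two previous lemmas `f = X^(2q) + aX^q + c` and `H_q f = 2X^q + a` (`q = p^k`); a common root `θ`
gives, with `u = θ^q`, `a = -2u` and then `c = -(u^2 + au) = u^2`, so `f = (X^q - u)^2 = (X - t)^(2q)` with
`t^q = u` (`t` exists as `R` is perfect). Written division-free, the argument needs no case distinction for
`p = 2` (where `2·2^k = 2^(k+1)` is also the prime-power case). [cite: GrafVonBothmerEtAl2007, Theorem (§2) and Prop. 6] -/
theorem holdsInDegree_two_mul_prime_pow (p : ℕ) [Fact p.Prime] [CharP R p] [PerfectRing R p] (k : ℕ) :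
    HoldsInDegree R (2 * p ^ k) := by
  intro f hf hd hca
  have hq : 0 < p ^ k := pow_pos (Fact.out : p.Prime).pos k
  have hf_eq := eq_of_natDegree_eq_two_mul_prime_pow hf hd hca
  obtain ⟨θ, hfθ, hHθ⟩ := hca (p ^ k) hq (by rw [hd]; omega)
  rw [hasseDeriv_prime_pow_of_natDegree_eq_two_mul_prime_pow hf hd hca] at hHθ
  rw [hf_eq] at hfθ
  simp only [eval_add, eval_mul, eval_C, eval_pow, eval_X] at hHθ hfθ
  -- with `u = θ^q`: `a = -2u` and `c = u^2`
  have ha : f.coeff (p ^ k) = -(2 * θ ^ p ^ k) := eq_neg_of_add_eq_zero_right hHθ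
  have hθ2 : θ ^ (2 * p ^ k) = (θ ^ p ^ k) ^ 2 := by rw [mul_comm, pow_mul]
  have hc : f.coeff 0 = (θ ^ p ^ k) ^ 2 := by
    rw [hθ2] at hfθ
    linear_combination hfθ - θ ^ p ^ k * hHθ
  have hb : ∀ u : R, ((iterateFrobeniusEquiv R p k).symm u) ^ p ^ k = u := fun u => by
    rw [← iterateFrobeniusEquiv_def, RingEquiv.apply_symm_apply]
  refine ⟨(iterateFrobeniusEquiv R p k).symm (θ ^ p ^ k), ?_⟩
  rw [mul_comm 2 (p ^ k), pow_mul, sub_pow_char_pow, ← map_pow, hb (θ ^ p ^ k)]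
  conv_lhs => rw [hf_eq, ha, hc, mul_comm 2 (p ^ k), pow_mul]
  simp only [map_neg, map_mul, map_pow, map_ofNat]
  ring

end CharP

end Literature.Algebra.Polynomial.CasasAlvero
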